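import Mathlib
import Summits.NavierStokesRegularity.NavierStokesRegularity.Theorems.FilamentSkeletonRssDefectColumnGateAzimuthalBlockCoreDissip
import Summits.NavierStokesRegularity.NavierStokesRegularity.Theorems.FilamentSkeletonRssDefectColumnGateAzimuthalBlockCoreGaussPrelim

/-!
# Route `FilamentSkeletonRss` · crux `TransverseReduction1AG` (stmt-NavierStokesRegularity-27853; A1L twin stmt-23297) · line
# `defect_column_gate_1AG/1AL` — the GAUSSIAN-CLASS FAST-ROTATION SUP BOUND for the Biot–Savart-coupled azimuthal blocks `m ≥ 2` of
# S2a-loc `WaistColumnGateLoc1A`: `sup |ω_m|² ≤ C(γ,m,R)·M²/Rc` — the `1/Rc` gain at the sup level, for every large circulation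

Helper file (`--supports stmt-NavierStokesRegularity-27853 --as helper`; seat ns-filament-s2aloc-p1 g2; the CORE HALF of the two-zone scheme of the note
ARCHITECTURE-B2B3-s2aloc-g2.md v2 §6, assembled end-to-end in the Gaussian class).  Built on `…AzimuthalBlockCoreDissip.lean` (brick (Re)),
`…AzimuthalBlockCoreTrunc.lean` (brick (Im)), `…AzimuthalBlockCoreGaussPrelim.lean` (pointwise lemmas, the real algebra, extraction).

THE RESULT (`coreGauss_sup_sq_le`; dictionary as in `…AzimuthalBlockCore.lean`).  Symmetric column, azimuthal order `m ≥ 2`, frame rotation `ρ`,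
circulation `Rc ≥ 1` with `40π|ρ|(U + 4/γ) ≤ Rc`, coupled block (OU + rotation + Biot–Savart) on `(0,U)` with forcing `(1+u)²|f_i| ≤ M`, mode and
stream coefficients vanishing at `U` (support radius `R = √U`) and at the axis.  Then for every `u ∈ [0, U]`:
`a(u)² + b(u)² ≤ (U e^{γU/4}/Rc)·(100·K((γ+1)K + 4)/m² + 1)·M²`,  `K = 2π(U + 4/γ)`.
So in the Gaussian class (support radius with `e^{γR²/4}` affordable) the forced response of every non-dipole azimuthal block DECAYS like `Rc^{−1/2}`
in sup norm — the fast-rotation gain, with no enhanced-dissipation input, uniformly in `ρ` within the stated window.  The two-zone scheme of the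
note replaces `e^{γU/4}` by `Rc^A` (core `U ↦ u₀ = (4A/γ)log Rc`) plus the V-blind exterior (p671778); that assembly is NOT done here.

THE CHAIN (all kernel-checked bricks): (Im) `core_rotation_coercivity_trunc` at `u₁ = U` pays `Rc·𝒞`, `𝒞 = ∫₀^U EΩs`, by the forcing (AM–GM with
`η = c₁Rc/(2K)`, `c₁ = (1 − 16/(5m²))m ≥ m/5`) once `m|ρ|K ≤ c₁Rc/4`; (P) `E ≤ 2π(u + 4/γ)·EΩ` pointwise (`γu/4 ≤ e^{γu/4} − 1`), so `∫Es ≤ K𝒞`;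
(Re) `core_dissipation_trunc` at `u₁ = U` bounds `D + D₂ = ∫₀^U E(4u|w′|² + m²s/u)` by `(γ + Rc)K𝒞 + M²UE(U)/(2Rc) + (16/5m)Rc𝒞`;
(X) `sq_le_extraction_of_mem` on dyadic intervals inside `(0,U]` gives `s(u) ≤ (3/m² + 1/4)(D + D₂)`.
HONEST FRAMING: an a-priori bound for ONE family of blocks of ONE linear MODEL operator of a hypothetical blow-up route (MODEL rung, negative side);
`WaistColumnGateLoc1A`, `TransverseReduction1AG/1AL` are neither proved nor refuted; nothing here bears on NS regularity.
-/

set_option linter.dupNamespace false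

noncomputable section

namespace Summit.NavierStokesRegularity.NavierStokesRegularity.Theorems.DefectColumnGate

open scoped Topology
open Set Filter MeasureTheory intervalIntegral

set_option maxHeartbeats 1600000 in
/-- **Gaussian-class fast-rotation sup bound for the Biot–Savart-coupled azimuthal block (`m ≥ 2`).**  See the module docstring for the
dictionary and the chain.  Conclusion: for all `u ∈ [0,U]`,
`a(u)² + b(u)² ≤ (U·e^{γU/4}/Rc)·(100·K·((γ+1)K + 4)/m² + 1)·M²`, `K = 2π(U + 4/γ)`, whenever `Rc ≥ 1` and `40π|ρ|(U + 4/γ) ≤ Rc`. -/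
theorem coreGauss_sup_sq_le {γ m ρ Rc U M : ℝ} {a a₁ b b₁ φa φa₁ φb φb₁ f₁ f₂ : ℝ → ℝ}
    (hγ : 0 < γ) (hm : 2 ≤ m) (hRc : 1 ≤ Rc) (hU : 0 < U) (hρ : 40 * Real.pi * |ρ| * (U + 4 / γ) ≤ Rc)
    (ha : ContinuousOn a (Icc 0 U)) (hb : ContinuousOn b (Icc 0 U))
    (ha₁ : ContinuousOn a₁ (Ioc 0 U)) (hb₁ : ContinuousOn b₁ (Ioc 0 U))
    (hφa : ContinuousOn φa (Icc 0 U)) (hφb : ContinuousOn φb (Icc 0 U))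
    (hΦac : ContinuousOn (fun s => 4 * s * a₁ s + γ * s * a s) (Icc 0 U))
    (hΦbc : ContinuousOn (fun s => 4 * s * b₁ s + γ * s * b s) (Icc 0 U))
    (hPac : ContinuousOn (fun s => s * φa₁ s) (Icc 0 U)) (hPbc : ContinuousOn (fun s => s * φb₁ s) (Icc 0 U))
    (ha0 : a 0 = 0) (hb0 : b 0 = 0) (hφa0 : φa 0 = 0) (hφb0 : φb 0 = 0)
    (hdera : ∀ u ∈ Ioo 0 U, HasDerivAt a (a₁ u) u) (hderb : ∀ u ∈ Ioo 0 U, HasDerivAt b (b₁ u) u)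
    (hderφa : ∀ u ∈ Ioo 0 U, HasDerivAt φa (φa₁ u) u) (hderφb : ∀ u ∈ Ioo 0 U, HasDerivAt φb (φb₁ u) u)
    (hΦa : ∀ u ∈ Ioo 0 U, HasDerivAt (fun s => 4 * s * a₁ s + γ * s * a s)
      (m ^ 2 / u * a u - m * (ρ + Rc * ((1 - Real.exp (-(γ * u / 4))) / (2 * Real.pi * u))) * b u
        + γ * m * Rc / 2 * (γ / (4 * Real.pi) * Real.exp (-(γ * u / 4))) * φb u - f₁ u) u)
    (hΦb : ∀ u ∈ Ioo 0 U, HasDerivAt (fun s => 4 * s * b₁ s + γ * s * b s)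
      (m ^ 2 / u * b u + m * (ρ + Rc * ((1 - Real.exp (-(γ * u / 4))) / (2 * Real.pi * u))) * a u
        - γ * m * Rc / 2 * (γ / (4 * Real.pi) * Real.exp (-(γ * u / 4))) * φa u - f₂ u) u)
    (hPa : ∀ u ∈ Ioo 0 U, HasDerivAt (fun s => s * φa₁ s) ((m ^ 2 / u * φa u - a u) / 4) u)
    (hPb : ∀ u ∈ Ioo 0 U, HasDerivAt (fun s => s * φb₁ s) ((m ^ 2 / u * φb u - b u) / 4) u)
    (haU : a U = 0) (hbU : b U = 0) (hφaU : φa U = 0) (hφbU : φb U = 0)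
    (hf₁ : ∀ u ∈ Icc 0 U, (1 + u) ^ 2 * |f₁ u| ≤ M) (hf₂ : ∀ u ∈ Icc 0 U, (1 + u) ^ 2 * |f₂ u| ≤ M)
    (hIΩ : IntervalIntegrable (fun u => Real.exp (γ * u / 4)
      * ((1 - Real.exp (-(γ * u / 4))) / (2 * Real.pi * u)) * (a u ^ 2 + b u ^ 2)) volume 0 U)
    (hIE : IntervalIntegrable (fun u => Real.exp (γ * u / 4) * (a u ^ 2 + b u ^ 2)) volume 0 U)
    (hIf : IntervalIntegrable (fun u => Real.exp (γ * u / 4) * (a u * f₂ u - b u * f₁ u)) volume 0 U)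
    (hIg : IntervalIntegrable (fun u => Real.exp (γ * u / 4) * (a u * f₁ u + b u * f₂ u)) volume 0 U)
    (hID₁ : IntervalIntegrable (fun u => Real.exp (γ * u / 4) * (4 * u * (a₁ u ^ 2 + b₁ u ^ 2))) volume 0 U)
    (hID₂ : IntervalIntegrable (fun u => Real.exp (γ * u / 4) * (m ^ 2 / u * (a u ^ 2 + b u ^ 2))) volume 0 U)
    (hIaφ : IntervalIntegrable (fun u => a u * φa u) volume 0 U)
    (hIbφ : IntervalIntegrable (fun u => b u * φb u) volume 0 U)
    (hIBa₁ : IntervalIntegrable (fun u => 4 * u * φa₁ u ^ 2) volume 0 U)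
    (hIBa₂ : IntervalIntegrable (fun u => m ^ 2 / u * φa u ^ 2) volume 0 U)
    (hIBb₁ : IntervalIntegrable (fun u => 4 * u * φb₁ u ^ 2) volume 0 U)
    (hIBb₂ : IntervalIntegrable (fun u => m ^ 2 / u * φb u ^ 2) volume 0 U)
    (hIua : IntervalIntegrable (fun u => u * a u ^ 2) volume 0 U)
    (hIub : IntervalIntegrable (fun u => u * b u ^ 2) volume 0 U)
    (hIcross : IntervalIntegrable (fun u => b u * φa u - a u * φb u) volume 0 U) :
    ∀ u ∈ Icc 0 U, a u ^ 2 + b u ^ 2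
      ≤ (U * Real.exp (γ * U / 4) / Rc)
        * (100 * (2 * Real.pi * (U + 4 / γ)) * ((γ + 1) * (2 * Real.pi * (U + 4 / γ)) + 4) / m ^ 2 + 1) * M ^ 2 := by
  have hm0 : 0 < m := by linarith
  have hm0' : m ≠ 0 := hm0.ne'
  have hπ : 0 < Real.pi := Real.pi_pos
  have hRc0 : 0 < Rc := by linarith
  have hU0 : 0 ≤ U := hU.le
  have hM : 0 ≤ M := le_trans (by positivity) (hf₁ 0 (left_mem_Icc.2 hU0))
  -- constants
  set K : ℝ := 2 * Real.pi * (U + 4 / γ) with hKdef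
  have hK : 0 < K := by positivity
  set c₁ : ℝ := (1 - 16 / (5 * m ^ 2)) * m with hc₁def
  have hc₁m : m / 5 ≤ c₁ := by
    rw [hc₁def]
    have : 16 / (5 * m ^ 2) ≤ 4 / 5 := by
      rw [div_le_div_iff₀ (by positivity) (by norm_num)]; nlinarith
    nlinarith
  have hc₁ : 0 < c₁ := lt_of_lt_of_le (by positivity) hc₁m
  -- (Im) at `u₁ = U`
  have hIm := core_rotation_coercivity_trunc hγ hm hRc0.le hU0 le_rfl ha hb hφa hφb hΦac hΦbc hPac hPbc hφa0 hφb0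
    hdera hderb hderφa hderφb hΦa hΦb hPa hPb hφaU hφbU hIΩ hIE hIf hIaφ hIbφ hIBa₁ hIBa₂ hIBb₁ hIBb₂ hIua hIub
  simp only [haU, hbU, mul_zero, zero_mul, sub_zero, add_zero, intervalIntegral.integral_same] at hIm
  -- (Re) at `u₁ = U`
  have hID : IntervalIntegrable (fun u => Real.exp (γ * u / 4)
      * (4 * u * (a₁ u ^ 2 + b₁ u ^ 2) + m ^ 2 / u * (a u ^ 2 + b u ^ 2))) volume 0 U := by
    have e : (fun u => Real.exp (γ * u / 4) * (4 * u * (a₁ u ^ 2 + b₁ u ^ 2) + m ^ 2 / u * (a u ^ 2 + b u ^ 2)))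
        = fun u => Real.exp (γ * u / 4) * (4 * u * (a₁ u ^ 2 + b₁ u ^ 2))
          + Real.exp (γ * u / 4) * (m ^ 2 / u * (a u ^ 2 + b u ^ 2)) := by funext u; ring
    rw [e]; exact hID₁.add hID₂
  have hRe := core_dissipation_trunc hγ hm hRc0.le hU0 le_rfl ha hb hφa hφb hΦac hΦbc hPac hPbc hφa0 hφb0
    hdera hderb hderφa hderφb hΦa hΦb hPa hPb hφaU hφbU hIΩ hIE hIg hID hIaφ hIbφ hIBa₁ hIBa₂ hIBb₁ hIBb₂ hIua hIub hIcross
  simp only [haU, hbU, mul_zero, zero_mul, sub_zero, add_zero, intervalIntegral.integral_same,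
    zero_pow two_ne_zero] at hRe
  have hDsplit : ∫ u in (0:ℝ)..U, Real.exp (γ * u / 4) * (4 * u * (a₁ u ^ 2 + b₁ u ^ 2) + m ^ 2 / u * (a u ^ 2 + b u ^ 2))
      = (∫ u in (0:ℝ)..U, Real.exp (γ * u / 4) * (4 * u * (a₁ u ^ 2 + b₁ u ^ 2)))
        + ∫ u in (0:ℝ)..U, Real.exp (γ * u / 4) * (m ^ 2 / u * (a u ^ 2 + b u ^ 2)) := by
    rw [← integral_add hID₁ hID₂]; congr 1; funext u; ring
  rw [hDsplit] at hRe
  -- currencies (plain names, no unfolding needed later)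
  set 𝒞 : ℝ := ∫ u in (0:ℝ)..U, Real.exp (γ * u / 4)
      * ((1 - Real.exp (-(γ * u / 4))) / (2 * Real.pi * u)) * (a u ^ 2 + b u ^ 2) with h𝒞def
  set IE : ℝ := ∫ u in (0:ℝ)..U, Real.exp (γ * u / 4) * (a u ^ 2 + b u ^ 2) with hIEdef
  set I₄ : ℝ := ∫ u in (0:ℝ)..U, Real.exp (γ * u / 4) / (1 + u) ^ 4 with hI₄def
  have h𝒞0 : 0 ≤ 𝒞 := integral_nonneg hU0 (fun u hu => by
    have h1 : 0 ≤ 1 - Real.exp (-(γ * u / 4)) := by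
      have : Real.exp (-(γ * u / 4)) ≤ 1 := Real.exp_le_one_iff.mpr (by nlinarith [hu.1, hγ])
      linarith
    have := hu.1
    positivity)
  have hIE0 : 0 ≤ IE := integral_nonneg hU0 (fun u _ => by positivity)
  have hI₄c : ContinuousOn (fun u : ℝ => Real.exp (γ * u / 4) / (1 + u) ^ 4) (Icc 0 U) := by
    apply ContinuousOn.div
    · exact (Real.continuous_exp.comp (by continuity)).continuousOn
    · exact (continuousOn_const.add continuousOn_id).pow 4
    · intro u hu; have := hu.1; positivity
  have hI₄int : IntervalIntegrable (fun u : ℝ => Real.exp (γ * u / 4) / (1 + u) ^ 4) volume 0 U :=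
    hI₄c.intervalIntegrable_of_Icc hU0
  have hI₄0 : 0 ≤ I₄ := integral_nonneg hU0 (fun u hu => by have := hu.1; positivity)
  have hI₄ : I₄ ≤ U * Real.exp (γ * U / 4) := by
    have h1 : I₄ ≤ ∫ _ in (0:ℝ)..U, Real.exp (γ * U / 4) := by
      apply integral_mono_on hU0 hI₄int _root_.intervalIntegrable_const
      intro u hu
      have hE : Real.exp (γ * u / 4) ≤ Real.exp (γ * U / 4) := Real.exp_le_exp.mpr (by nlinarith [hu.2, hγ])
      have h1u : 1 ≤ (1 + u) ^ 4 := one_le_pow₀ (by linarith [hu.1])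
      calc Real.exp (γ * u / 4) / (1 + u) ^ 4 ≤ Real.exp (γ * u / 4) / 1 :=
            div_le_div_of_nonneg_left (Real.exp_pos _).le one_pos h1u
        _ ≤ Real.exp (γ * U / 4) := by simpa using hE
    rw [intervalIntegral.integral_const, smul_eq_mul] at h1
    linarith
  -- (P) `IE ≤ K 𝒞`
  have hP : IE ≤ K * 𝒞 := by
    rw [hIEdef, h𝒞def, ← intervalIntegral.integral_const_mul]
    apply integral_mono_on hU0 hIE (hIΩ.const_mul _)
    intro u hu
    rcases eq_or_lt_of_le hu.1 with h | h
    · subst h; simp [ha0, hb0]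
    · have hs : 0 ≤ a u ^ 2 + b u ^ 2 := by positivity
      have h1 := exp_le_rot_weight hγ h hs
      have h2 : 2 * Real.pi * (u + 4 / γ) ≤ K := by rw [hKdef]; nlinarith [hu.2, hπ]
      have h3 : 0 ≤ Real.exp (γ * u / 4) * ((1 - Real.exp (-(γ * u / 4))) / (2 * Real.pi * u)) * (a u ^ 2 + b u ^ 2) := by
        have h4 : 0 ≤ 1 - Real.exp (-(γ * u / 4)) := by
          have : Real.exp (-(γ * u / 4)) ≤ 1 := Real.exp_le_one_iff.mpr (by nlinarith [hγ, h])
          linarith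
        positivity
      exact h1.trans (mul_le_mul_of_nonneg_right h2 h3)
  -- pointwise AM–GM for the two forcing pairings, integrated
  have hpair : ∀ η : ℝ, 0 < η →
      (∫ u in (0:ℝ)..U, Real.exp (γ * u / 4) * (a u * f₂ u - b u * f₁ u)) ≤ η / 2 * IE + M ^ 2 * I₄ / η ∧
      (∫ u in (0:ℝ)..U, Real.exp (γ * u / 4) * (a u * f₁ u + b u * f₂ u)) ≤ η / 2 * IE + M ^ 2 * I₄ / η := by
    intro η hη
    have hrhs : IntervalIntegrable (fun u => η / 2 * (Real.exp (γ * u / 4) * (a u ^ 2 + b u ^ 2))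
        + M ^ 2 / η * (Real.exp (γ * u / 4) / (1 + u) ^ 4)) volume 0 U :=
      (hIE.const_mul _).add (hI₄int.const_mul _)
    have hrhs_val : ∫ u in (0:ℝ)..U, (η / 2 * (Real.exp (γ * u / 4) * (a u ^ 2 + b u ^ 2))
        + M ^ 2 / η * (Real.exp (γ * u / 4) / (1 + u) ^ 4)) = η / 2 * IE + M ^ 2 * I₄ / η := by
      rw [integral_add (hIE.const_mul _) (hI₄int.const_mul _), intervalIntegral.integral_const_mul,
        intervalIntegral.integral_const_mul, hIEdef, hI₄def]
      ring
    have hpt : ∀ u ∈ Icc 0 U,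
        Real.exp (γ * u / 4) * (a u * f₂ u - b u * f₁ u)
          ≤ η / 2 * (Real.exp (γ * u / 4) * (a u ^ 2 + b u ^ 2)) + M ^ 2 / η * (Real.exp (γ * u / 4) / (1 + u) ^ 4) ∧
        Real.exp (γ * u / 4) * (a u * f₁ u + b u * f₂ u)
          ≤ η / 2 * (Real.exp (γ * u / 4) * (a u ^ 2 + b u ^ 2)) + M ^ 2 / η * (Real.exp (γ * u / 4) / (1 + u) ^ 4) := by
      intro u hu
      have h1u : 0 < (1 + u) ^ 2 := by have := hu.1; positivity
      have hg₁ : |f₁ u| ≤ M / (1 + u) ^ 2 := by rw [le_div_iff₀ h1u]; linarith [hf₁ u hu]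
      have hg₂ : |f₂ u| ≤ M / (1 + u) ^ 2 := by rw [le_div_iff₀ h1u]; linarith [hf₂ u hu]
      obtain ⟨hA, hB⟩ := pairing_amgm (a := a u) (b := b u) hη hg₁ hg₂
      have hE0 : 0 ≤ Real.exp (γ * u / 4) := (Real.exp_pos _).le
      have e : Real.exp (γ * u / 4) * (η / 2 * (a u ^ 2 + b u ^ 2) + (M / (1 + u) ^ 2) ^ 2 / η)
          = η / 2 * (Real.exp (γ * u / 4) * (a u ^ 2 + b u ^ 2)) + M ^ 2 / η * (Real.exp (γ * u / 4) / (1 + u) ^ 4) := by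
        field_simp
      constructor
      · have := mul_le_mul_of_nonneg_left hB hE0; linarith
      · have := mul_le_mul_of_nonneg_left hA hE0; linarith
    constructor
    · rw [← hrhs_val]; exact integral_mono_on hU0 hIf hrhs (fun u hu => (hpt u hu).1)
    · rw [← hrhs_val]; exact integral_mono_on hU0 hIg hrhs (fun u hu => (hpt u hu).2)
  have hIm' : c₁ * Rc * 𝒞 + m * ρ * IE ≤ ∫ u in (0:ℝ)..U, Real.exp (γ * u / 4) * (a u * f₂ u - b u * f₁ u) := by
    have e : (1 - 16 / (5 * m ^ 2)) * (m * Rc) * 𝒞 = c₁ * Rc * 𝒞 := by rw [hc₁def]; ring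
    rw [← e]; exact hIm
  have hρK : m * |ρ| * K ≤ c₁ * Rc / 4 := by
    have h1 : |ρ| * K ≤ Rc / 20 := by
      rw [hKdef]
      have : 40 * Real.pi * |ρ| * (U + 4 / γ) = 20 * (|ρ| * (2 * Real.pi * (U + 4 / γ))) := by ring
      linarith [hρ]
    have h2 : m * |ρ| * K ≤ m * (Rc / 20) := by
      have := mul_le_mul_of_nonneg_left h1 hm0.le; linarith [mul_assoc m (|ρ|) K]
    nlinarith [hc₁m]
  have hη : 0 < c₁ * Rc / K := by positivity
  have hrot := (hpair (c₁ * Rc / K) hη).1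
  have h𝒞 : 𝒞 ≤ 4 * K * (M ^ 2 * I₄) / (c₁ ^ 2 * Rc ^ 2) :=
    gauss_currency_bound hK hc₁ hRc0 hm0 h𝒞0 hIE0 hP hIm' hrot hρK
  have hdis := (hpair (2 * Rc) (by positivity)).2
  have hDD := gauss_dissipation_bound (DD := (∫ u in (0:ℝ)..U, Real.exp (γ * u / 4) * (4 * u * (a₁ u ^ 2 + b₁ u ^ 2)))
        + ∫ u in (0:ℝ)..U, Real.exp (γ * u / 4) * (m ^ 2 / u * (a u ^ 2 + b u ^ 2)))
    hK hc₁ hRc hγ hm h𝒞0 hRe hP hdis h𝒞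
  have hfin := gauss_final_bound (M := M) hK hc₁ hRc0 hγ hm0 hc₁m hI₄0 hI₄
  -- extraction and conclusion
  have hD0 : 0 ≤ ∫ u in (0:ℝ)..U, Real.exp (γ * u / 4) * (4 * u * (a₁ u ^ 2 + b₁ u ^ 2)) :=
    integral_nonneg hU0 (fun u hu => by have := hu.1; positivity)
  have hD₂0 : 0 ≤ ∫ u in (0:ℝ)..U, Real.exp (γ * u / 4) * (m ^ 2 / u * (a u ^ 2 + b u ^ 2)) :=
    integral_nonneg hU0 (fun u hu => by have := hu.1; positivity)
  have hbound0 : 0 ≤ (U * Real.exp (γ * U / 4) / Rc)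
      * (100 * K * ((γ + 1) * K + 4) / m ^ 2 + 1) * M ^ 2 := by positivity
  intro u hu
  rcases eq_or_lt_of_le hu.1 with h | hu0
  · subst h; rw [ha0, hb0]; simpa [hKdef] using hbound0
  · have hX := core_extraction_le hγ hm0' hU ha hb ha₁ hb₁ hdera hderb hID₁ hID₂ u ⟨hu0, hu.2⟩
    have h3m : 3 / m ^ 2 ≤ 1 := by rw [div_le_iff₀ (by positivity)]; nlinarith
    have h1 : 3 / m ^ 2 * (∫ v in (0:ℝ)..U, Real.exp (γ * v / 4) * (m ^ 2 / v * (a v ^ 2 + b v ^ 2)))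
        ≤ ∫ v in (0:ℝ)..U, Real.exp (γ * v / 4) * (m ^ 2 / v * (a v ^ 2 + b v ^ 2)) := by
      have := mul_le_mul_of_nonneg_right h3m hD₂0; linarith
    have h2 : 1 / 4 * (∫ v in (0:ℝ)..U, Real.exp (γ * v / 4) * (4 * v * (a₁ v ^ 2 + b₁ v ^ 2)))
        ≤ ∫ v in (0:ℝ)..U, Real.exp (γ * v / 4) * (4 * v * (a₁ v ^ 2 + b₁ v ^ 2)) := by linarith
    have : a u ^ 2 + b u ^ 2 ≤ (U * Real.exp (γ * U / 4) / Rc) * (100 * K * ((γ + 1) * K + 4) / m ^ 2 + 1) * M ^ 2 := by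
      linarith [hX, h1, h2, hDD, hfin]
    simpa [hKdef] using this

end Summit.NavierStokesRegularity.NavierStokesRegularity.Theorems.DefectColumnGate

end
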